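import Literature.NumberTheory.Automorphic.ArchRankOneCasimirBoostJets            -- ★ Z3(a): boosts in `G₂`, compact carriers, `integral_boostJet_eq_zero`, `boost_jets_sum_eq_radial`
import HarnessLib

/-!
# The radial differential equation of the Casimir on `U(e₀,e₁)` (`e₀e₁ < 0`):
# `sin²ψ · (O_{Ωf}(ψ) + O″(ψ)) + 2 sin ψ cos ψ · O′(ψ) = 0` for the orbital integral `O(ψ) = ∫_{G₂} f(h γ_ψ h⁻¹) dμ(h)` (Varadarajan 1989 §6.3–§6.4)

Topic `NumberTheory/Automorphic`; namespace `Literature.NumberTheory.Automorphic.RankOneCasimir`.  THEOREMS ONLY (no `def`, no instance, no notation, no axiom, no named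
fact, no `sorry`).  Cell `pub/hodgecm-mathlib`, ENGINE T1 (crux H413 = `stmt-HodgeConjecture-24833`); ROAD (Z) toward the row (J3-odd)₃ = [Varadarajan1989 §6.4 Thm 24, `r = 1`]
descended (census `CENSUS-J3odd3-InHouse.A-p18g25.md` 7db511ac), FILE Z3 of five, PART (b) over ★ Z3(a) `ArchRankOneCasimirBoostJets`.  Author A-p18 (g26), 2026-09-01, on the g25
recipe `HANDOFF-Z3-RadialODE.A-p18g25.md`.

SETTING.  `G₂ = archLocal L 2 (diag a) w = U(σ_w diag a)(ℂ) ≤ GL₂(ℂ)` (`a_i ≠ 0`, `e_i = σ_w a_i` real, `q²e₁ = −e₀`, `pq = 1`, so `e₀e₁ < 0` and `G₂ ≅ U(1,1)`), `μ` a measure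
on `G₂` finite on compacta and RIGHT-invariant (every Haar measure: `G₂` is unimodular, ★ `modularCharacterFun_archLocal_eq_one` + ★ `isMulRightInvariant_of_modularCharacterFun_eq_one`),
`f ∈ C²_c(M₂(ℂ), E)`, `z ∈ S¹`, `γ_ψ = M(ψ) = diag(z e^{iψ}, z e^{−iψ})`, `X₁ = diag(i,−i)`, `X̂₂ = [[0,p],[q,0]]`, `X̂₃ = [[0,−ip],[iq,0]]` (★ Z1).  Writing `T = ↑↑h`,
`T′ = ↑↑h⁻¹`, `Y = TMT′`:  `O(ψ) = ∫ f(Y) dμ`, `O′(ψ) = ∫ Df(Y)[T(MX₁)T′]`, `O″(ψ) = ∫ D²f(Y)[T(MX₁)T′]² + Df(Y)[T(MX₁X₁)T′]`, `O_{Ωf}(ψ) = ∫ (Ωf)(Y)` with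
`(Ωf)(Y) = −(D²f(Y)[YX₁]² + Df(Y)[YX₁X₁]) + (D²f(Y)[YX̂₂]² + Df(Y)[YX̂₂X̂₂]) + (D²f(Y)[YX̂₃]² + Df(Y)[YX̂₃X̂₃])` (the `½tr`-Casimir `−X₁² + X̂₂² + X̂₃²` of `𝔰𝔲(H)` as a
second-order left-invariant operator, written through `D²f`, `Df`).  All of `M, Ω, O, O′, O″, O_Ω` enter the statements as bound variables with defining hypotheses (`hM`, `hΩ`,
`hO`, …), so that FILE Z4 instantiates them by `fun _ => rfl`.

WHAT IS PROVED.
* **`hasDerivAt_orbitalIntegral_torusCurve`**: on `{sin ψ ≠ 0}`, `O` has derivative `O′(ψ)` and `O′` has derivative `O″(ψ)` (★ Z2 along the torus curve, ★ Z1 `hasDerivAt_torusCurve`;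
  compact carrier `{h | ∃ |ψ′ − ψ| ≤ δ, h t_{ψ′} h⁻¹ ∈ supp f}` over a closed ball of REGULAR parameters, ★ `isCompact_setOf_exists_conj_circleDiagonal_mem`), with the
  integrability of both integrands (no right-invariance needed here).
* **`sin_sq_smul_orbital_casimir_add_eq_zero`** (MAIN): `sin²ψ • (O_{Ωf}(ψ) + O″(ψ)) + (2 sin ψ cos ψ) • O′(ψ) = 0` — ★ Z3(a) §3 (`integral_boostJet_eq_zero`) for `X̂₂`, `X̂₃`,
  summed; ★ Z3(a) §4 (`boost_jets_sum_eq_radial`, `B = D²f(Y)`, `ℓ = Df(Y)`, `TᴴHT = H` from `h ∈ G₂`) pointwise under the integral; integrability from the first theorem,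
  from §3, and from `Ω ∘ Ad_h(M)` continuous with the compact support of ★ Z3(a) §2; then `2 − 2cos 2ψ = 4 sin²ψ`, `4 sin 2ψ = 8 sin ψ cos ψ`, division by `4`.
FILE Z4 divides by `sin ψ` and reads `F″ = −F − F_{Ωf}` for `F = 2 sin ψ · O`, hence `F‴ → −C·(f + Ωf)(z·1)` by ★ (R1G) applied to `f` and to `Ωf`.
HONEST LABEL: elementary real analysis on `U(1,1)`; pays nothing by itself (HC_CM is proved only modulo the printed citations until rung 0 closes).

## References
* [Varadarajan1989] V. S. Varadarajan, *An Introduction to Harmonic Analysis on Semisimple Lie Groups* (1989), §6.3 (radial component of `Ω` on the regular elliptic set: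
  `F_{Ωf} = −(F_f″ + F_f)`), §6.4 Thms 22–24.
* [Folland1995] G. B. Folland, *A Course in Abstract Harmonic Analysis* (1995), §2.6 (invariant integration; differentiation under Haar integrals).
* [Rogawski1990] J. D. Rogawski, *Automorphic Representations of Unitary Groups in Three Variables*, Ann. of Math. Stud. 123 (1990), §8.2 pp. 119–123.
-/

set_option autoImplicit false

namespace Literature.NumberTheory.Automorphic.RankOneCasimir

open _root_.Complex _root_.Matrix _root_.MeasureTheory _root_.Set _root_.Filter _root_.Topology _root_.NumberField _root_.NumberField.InfinitePlace
open _root_.Literature.NumberTheory.Automorphic.UnitaryGroup _root_.Literature.NumberTheory.Automorphic.ConjugationCurve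
open scoped Matrix.Norms.Operator MatrixGroups ComplexConjugate

variable (L : Type) [Field L] (a : Fin 2 → L) (w : {w : InfinitePlace L // IsComplex w})

/-! ## §5 Under the integral sign: the torus-curve jets `O′`, `O″`, and the radial equation -/

section Radial

variable {E : Type*} [NormedAddCommGroup E] [NormedSpace ℝ E] [CompleteSpace E]
variable [MeasurableSpace (archLocal L 2 (Matrix.diagonal a) w)] [BorelSpace (archLocal L 2 (Matrix.diagonal a) w)]

/-- **`O′` and `O″` under the integral sign on the regular set.**  For `f ∈ C²_c`, `a_i ≠ 0`, `μ` finite on compacta, the torus curve `M(ψ) = diag(z e^{iψ}, z e^{−iψ})`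
(`M′ = MX₁`, `(MX₁)′ = MX₁X₁`, ★ Z1 `hasDerivAt_torusCurve`) and `sin ψ ≠ 0`: the integrands of `O′(ψ) = ∫ Df(Y)[T(MX₁)T′]` and `O″(ψ) = ∫ D²f(Y)[T(MX₁)T′]² + Df(Y)[T(MX₁X₁)T′]`
are integrable, `O` has derivative `O′(ψ)` at `ψ` and `O′` has derivative `O″(ψ)` at `ψ` (★ Z2 with the compact carrier `{h | ∃ |ψ′−ψ| ≤ δ, h t_{ψ′} h⁻¹ ∈ supp f}`, `sin ≠ 0` on
the closed `δ`-ball, ★ `isCompact_setOf_exists_conj_circleDiagonal_mem`).  `M, O, O′, O″` are bound variables with defining hypotheses. [cite: Varadarajan1989, §6.4]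
[cite: Folland1995, §2.6] -/
theorem hasDerivAt_orbitalIntegral_torusCurve (μ : Measure (archLocal L 2 (Matrix.diagonal a) w)) [IsFiniteMeasureOnCompacts μ]
    (ha : ∀ i, a i ≠ 0) (f : Matrix (Fin 2) (Fin 2) ℂ → E) (hf : ContDiff ℝ 2 f) (hfc : HasCompactSupport f) (z : Circle)
    {M : ℝ → Matrix (Fin 2) (Fin 2) ℂ} (hM : ∀ ψ : ℝ, M ψ = Matrix.diagonal ![(z : ℂ) * cexp (ψ * I), (z : ℂ) * cexp (-(ψ * I))])
    {O O' O'' : ℝ → E} (hO : ∀ ψ : ℝ, O ψ = ∫ h : archLocal L 2 (Matrix.diagonal a) w, f (((h : GL (Fin 2) ℂ) : Matrix (Fin 2) (Fin 2) ℂ) * M ψ * (((h⁻¹ : archLocal L 2 (Matrix.diagonal a) w) : GL (Fin 2) ℂ) : Matrix (Fin 2) (Fin 2) ℂ)) ∂μ)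
    (hO' : ∀ ψ : ℝ, O' ψ = ∫ h : archLocal L 2 (Matrix.diagonal a) w, fderiv ℝ f (((h : GL (Fin 2) ℂ) : Matrix (Fin 2) (Fin 2) ℂ) * M ψ * (((h⁻¹ : archLocal L 2 (Matrix.diagonal a) w) : GL (Fin 2) ℂ) : Matrix (Fin 2) (Fin 2) ℂ)) (((h : GL (Fin 2) ℂ) : Matrix (Fin 2) (Fin 2) ℂ) * (M ψ * !![I, 0; 0, -I]) * (((h⁻¹ : archLocal L 2 (Matrix.diagonal a) w) : GL (Fin 2) ℂ) : Matrix (Fin 2) (Fin 2) ℂ)) ∂μ)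
    (hO'' : ∀ ψ : ℝ, O'' ψ = ∫ h : archLocal L 2 (Matrix.diagonal a) w, (fderiv ℝ (fderiv ℝ f) (((h : GL (Fin 2) ℂ) : Matrix (Fin 2) (Fin 2) ℂ) * M ψ * (((h⁻¹ : archLocal L 2 (Matrix.diagonal a) w) : GL (Fin 2) ℂ) : Matrix (Fin 2) (Fin 2) ℂ)) (((h : GL (Fin 2) ℂ) : Matrix (Fin 2) (Fin 2) ℂ) * (M ψ * !![I, 0; 0, -I]) * (((h⁻¹ : archLocal L 2 (Matrix.diagonal a) w) : GL (Fin 2) ℂ) : Matrix (Fin 2) (Fin 2) ℂ)) (((h : GL (Fin 2) ℂ) : Matrix (Fin 2) (Fin 2) ℂ) * (M ψ * !![I, 0; 0, -I]) * (((h⁻¹ : archLocal L 2 (Matrix.diagonal a) w) : GL (Fin 2) ℂ) : Matrix (Fin 2) (Fin 2) ℂ)) + fderiv ℝ f (((h : GL (Fin 2) ℂ) : Matrix (Fin 2) (Fin 2) ℂ) * M ψ * (((h⁻¹ : archLocal L 2 (Matrix.diagonal a) w) : GL (Fin 2) ℂ) : Matrix (Fin 2) (Fin 2) ℂ)) (((h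 : GL (Fin 2) ℂ) : Matrix (Fin 2) (Fin 2) ℂ) * (M ψ * !![I, 0; 0, -I] * !![I, 0; 0, -I]) * (((h⁻¹ : archLocal L 2 (Matrix.diagonal a) w) : GL (Fin 2) ℂ) : Matrix (Fin 2) (Fin 2) ℂ))) ∂μ)
    {ψ : ℝ} (hψ : Real.sin ψ ≠ 0) :
    Integrable (fun h : archLocal L 2 (Matrix.diagonal a) w => fderiv ℝ f (((h : GL (Fin 2) ℂ) : Matrix (Fin 2) (Fin 2) ℂ) * M ψ * (((h⁻¹ : archLocal L 2 (Matrix.diagonal a) w) : GL (Fin 2) ℂ) : Matrix (Fin 2) (Fin 2) ℂ)) (((h : GL (Fin 2) ℂ) : Matrix (Fin 2) (Fin 2) ℂ) * (M ψ * !![I, 0; 0, -I]) * (((h⁻¹ : archLocal L 2 (Matrix.diagonal a) w) : GL (Fin 2) ℂ) : Matrix (Fin 2) (Fin 2) ℂ))) μ ∧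
      Integrable (fun h : archLocal L 2 (Matrix.diagonal a) w => fderiv ℝ (fderiv ℝ f) (((h : GL (Fin 2) ℂ) : Matrix (Fin 2) (Fin 2) ℂ) * M ψ * (((h⁻¹ : archLocal L 2 (Matrix.diagonal a) w) : GL (Fin 2) ℂ) : Matrix (Fin 2) (Fin 2) ℂ)) (((h : GL (Fin 2) ℂ) : Matrix (Fin 2) (Fin 2) ℂ) * (M ψ * !![I, 0; 0, -I]) * (((h⁻¹ : archLocal L 2 (Matrix.diagonal a) w) : GL (Fin 2) ℂ) : Matrix (Fin 2) (Fin 2) ℂ)) (((h : GL (Fin 2) ℂ) : Matrix (Fin 2) (Fin 2) ℂ) * (M ψ * !![I, 0; 0, -I]) * (((h⁻¹ : archLocal L 2 (Matrix.diagonal a) w) : GL (Fin 2) ℂ) : Matrix (Fin 2) (Fin 2) ℂ)) + fderiv ℝ f (((h : GL (Fin 2) ℂ) : Matrix (Fin 2) (Fin 2) ℂ) * M ψ * (((h⁻¹ : archLocal L 2 (Matrix.diagonal a) w) : GL (Fin 2) ℂ) : Matrix (Fin 2) (Fin 2) ℂ)) (((h : GL (Fin 2) ℂ) : Matrix (Fin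 2) (Fin 2) ℂ) * (M ψ * !![I, 0; 0, -I] * !![I, 0; 0, -I]) * (((h⁻¹ : archLocal L 2 (Matrix.diagonal a) w) : GL (Fin 2) ℂ) : Matrix (Fin 2) (Fin 2) ℂ))) μ ∧
      HasDerivAt O (O' ψ) ψ ∧ HasDerivAt O' (O'' ψ) ψ := by
  -- the torus curve and its jets (★ Z1 §5)
  have hMfun : M = fun ψ : ℝ => Matrix.diagonal ![(z : ℂ) * cexp (ψ * I), (z : ℂ) * cexp (-(ψ * I))] := funext hM
  have hMd : ∀ s : ℝ, HasDerivAt M (M s * !![I, 0; 0, -I]) s := fun s => by rw [hMfun]; exact hasDerivAt_torusCurve (z : ℂ) s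
  have hMc : Continuous M := continuous_iff_continuousAt.2 fun s => (hMd s).continuousAt
  have hM₁d : ∀ s : ℝ, HasDerivAt (fun s => M s * !![I, 0; 0, -I]) (M s * !![I, 0; 0, -I] * !![I, 0; 0, -I]) s := fun s => (hMd s).mul_const _
  have hM₁c : Continuous fun s => M s * !![I, 0; 0, -I] := hMc.mul continuous_const
  have hM₂c : Continuous fun s => M s * !![I, 0; 0, -I] * !![I, 0; 0, -I] := hM₁c.mul continuous_const
  -- a closed ball of REGULAR parameters around `ψ`
  obtain ⟨δ, hδ, hδsin⟩ : ∃ δ > 0, ∀ ψ' ∈ Metric.closedBall ψ δ, Real.sin ψ' ≠ 0 := by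
    obtain ⟨ε, hε, hball⟩ := Metric.eventually_nhds_iff_ball.1 (Real.continuous_sin.continuousAt.eventually_ne hψ)
    exact ⟨ε / 2, half_pos hε, fun ψ' hψ' => hball ψ' (Metric.closedBall_subset_ball (half_lt_self hε) hψ')⟩
  -- the compact carrier over the closed ball (★ joint properness; `K_T` = the curve's image)
  have hcurve : Continuous fun ψ' : ℝ => (![z * Circle.exp ψ', z * Circle.exp (-ψ')] : Fin 2 → Circle) :=
    (continuous_const.mul Circle.exp.continuous).matrixVecCons
      ((continuous_const.mul (Circle.exp.continuous.comp continuous_neg)).matrixVecCons continuous_const)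
  have hKT : IsCompact ((fun ψ' : ℝ => (![z * Circle.exp ψ', z * Circle.exp (-ψ')] : Fin 2 → Circle)) '' Metric.closedBall ψ δ) :=
    (isCompact_closedBall ψ δ).image hcurve
  have hKTreg : (fun ψ' : ℝ => (![z * Circle.exp ψ', z * Circle.exp (-ψ')] : Fin 2 → Circle)) '' Metric.closedBall ψ δ ⊆ {v | Function.Injective v} := by
    rintro _ ⟨ψ', hψ', rfl⟩
    intro i j hij
    fin_cases i <;> fin_cases j
    · rfl
    · exact absurd hij (torusPoint_ne z (hδsin ψ' hψ'))
    · exact absurd hij.symm (torusPoint_ne z (hδsin ψ' hψ'))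
    · rfl
  have hK := isCompact_setOf_exists_conj_circleDiagonal_mem L 2 a w ha hKT hKTreg (isCompact_setOf_coe_archLocal_mem L 2 a w ha hfc.isCompact)
  have hsupp : ∀ s ∈ Metric.ball ψ δ, ∀ h : archLocal L 2 (Matrix.diagonal a) w, h ∉ {g : archLocal L 2 (Matrix.diagonal a) w |
      ∃ v ∈ (fun ψ' : ℝ => (![z * Circle.exp ψ', z * Circle.exp (-ψ')] : Fin 2 → Circle)) '' Metric.closedBall ψ δ,
        g * ⟨circleDiagonal 2 v, circleDiagonal_mem_archLocal_diagonal L 2 a w v⟩ * g⁻¹ ∈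
          {g : archLocal L 2 (Matrix.diagonal a) w | ((g : GL (Fin 2) ℂ) : Matrix (Fin 2) (Fin 2) ℂ) ∈ tsupport f}} →
      ((h : GL (Fin 2) ℂ) : Matrix (Fin 2) (Fin 2) ℂ) * M s * (((h⁻¹ : archLocal L 2 (Matrix.diagonal a) w) : GL (Fin 2) ℂ) : Matrix (Fin 2) (Fin 2) ℂ) ∉ tsupport f := by
    intro s hs h hh hmem
    apply hh
    refine ⟨![z * Circle.exp s, z * Circle.exp (-s)], ⟨s, Metric.ball_subset_closedBall hs, rfl⟩, ?_⟩
    simp only [Set.mem_setOf_eq]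
    rw [coe_conj_torusPoint, ← hM]
    exact hmem
  -- ★ Z2 (a), (b) along the torus curve
  have hZa := hasDerivAt_integral_comp_conj_curve (archLocal L 2 (Matrix.diagonal a) w) μ f (hf.of_le (by norm_num)) hMd hM₁c hδ hK hsupp
  have hZb := hasDerivAt_integral_fderiv_comp_conj_curve (archLocal L 2 (Matrix.diagonal a) w) μ f hf hMd hM₁d hM₂c hδ hK hsupp
  have hOfun : O = fun s : ℝ => ∫ h : archLocal L 2 (Matrix.diagonal a) w, f (((h : GL (Fin 2) ℂ) : Matrix (Fin 2) (Fin 2) ℂ) * M s * (((h⁻¹ : archLocal L 2 (Matrix.diagonal a) w) : GL (Fin 2) ℂ) : Matrix (Fin 2) (Fin 2) ℂ)) ∂μ := funext hO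
  have hO'fun : O' = fun s : ℝ => ∫ h : archLocal L 2 (Matrix.diagonal a) w, fderiv ℝ f (((h : GL (Fin 2) ℂ) : Matrix (Fin 2) (Fin 2) ℂ) * M s * (((h⁻¹ : archLocal L 2 (Matrix.diagonal a) w) : GL (Fin 2) ℂ) : Matrix (Fin 2) (Fin 2) ℂ)) (((h : GL (Fin 2) ℂ) : Matrix (Fin 2) (Fin 2) ℂ) * (M s * !![I, 0; 0, -I]) * (((h⁻¹ : archLocal L 2 (Matrix.diagonal a) w) : GL (Fin 2) ℂ) : Matrix (Fin 2) (Fin 2) ℂ)) ∂μ := funext hO'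
  refine ⟨hZa.1, hZb.1, ?_, ?_⟩
  · rw [hOfun, hO']; exact hZa.2
  · rw [hO'fun, hO'']; exact hZb.2

/-- **THE RADIAL DIFFERENTIAL EQUATION** (division-free form).  `G₂ = U(σ_w diag a)(ℂ)` with `a_i ≠ 0`, `σ_w a_i` real, `q²·σ_w a₁ = −σ_w a₀`, `pq = 1` (so `G₂ ≅ U(1,1)`,
`X̂₂, X̂₃ ∈ 𝔲(H)`); `μ` finite on compacta and RIGHT-invariant; `f ∈ C²_c(M₂(ℂ), E)`; `z ∈ S¹`; `sin ψ ≠ 0`.  With `M(ψ) = diag(z e^{iψ}, z e^{−iψ})`, `Y = TM(ψ)T′` (`T = ↑↑h`,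
`T′ = ↑↑h⁻¹`), `Ω(Y) = −(D²f(Y)[YX₁]² + Df(Y)[YX₁X₁]) + (D²f(Y)[YX̂₂]² + Df(Y)[YX̂₂X̂₂]) + (D²f(Y)[YX̂₃]² + Df(Y)[YX̂₃X̂₃])` (the Casimir `−X₁² + X̂₂² + X̂₃²` applied to `f`
through left-invariant fields), `O′(ψ) = ∫ Df(Y)[T(MX₁)T′]`, `O″(ψ) = ∫ D²f(Y)[T(MX₁)T′]² + Df(Y)[T(MX₁X₁)T′]`, `O_Ω(ψ) = ∫ Ω(Y)`:
**`sin²ψ • (O_Ω(ψ) + O″(ψ)) + (2 sin ψ cos ψ) • O′(ψ) = 0`.**  Proof: §3 (`integral_boostJet_eq_zero`) for `X̂₂` and `X̂₃`, summed; §4 (`boost_jets_sum_eq_radial` with `B = D²f(Y)`,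
`ℓ = Df(Y)`, `TᴴHT = H` from `h ∈ G₂`) pointwise under the integral; integrability from `hasDerivAt_orbitalIntegral_torusCurve`, §3, and `Ω ∘ Ad_h(M)` continuous with the compact
support of §2; finally `2 − 2cos 2ψ = 4 sin²ψ`, `4 sin 2ψ = 8 sin ψ cos ψ` and division by `4`.  All of `M, Ω, O, O′, O″, O_Ω` are bound variables with defining hypotheses
(FILE Z4 instantiates them by `fun _ => rfl` and reads `F″ = −F − F_{Ωf}` for `F = 2 sin ψ · O`). [cite: Varadarajan1989, §6.3] [cite: Folland1995, §2.6] [cite: Rogawski1990, §8.2 p. 119] -/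
theorem sin_sq_smul_orbital_casimir_add_eq_zero (μ : Measure (archLocal L 2 (Matrix.diagonal a) w)) [IsFiniteMeasureOnCompacts μ] [μ.IsMulRightInvariant]
    (ha : ∀ i, a i ≠ 0) (hreal : ∀ i, (w.1.embedding (a i)).im = 0) {p q : ℝ} (hpq : p * q = 1)
    (hqe : (q : ℂ) ^ 2 * w.1.embedding (a 1) = -w.1.embedding (a 0))
    (f : Matrix (Fin 2) (Fin 2) ℂ → E) (hf : ContDiff ℝ 2 f) (hfc : HasCompactSupport f) (z : Circle)
    {M : ℝ → Matrix (Fin 2) (Fin 2) ℂ} (hM : ∀ ψ : ℝ, M ψ = Matrix.diagonal ![(z : ℂ) * cexp (ψ * I), (z : ℂ) * cexp (-(ψ * I))])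
    {Ω : Matrix (Fin 2) (Fin 2) ℂ → E} (hΩ : ∀ Y : Matrix (Fin 2) (Fin 2) ℂ, Ω Y =
      -(fderiv ℝ (fderiv ℝ f) Y (Y * !![I, 0; 0, -I]) (Y * !![I, 0; 0, -I]) + fderiv ℝ f Y (Y * !![I, 0; 0, -I] * !![I, 0; 0, -I])) +
        (fderiv ℝ (fderiv ℝ f) Y (Y * !![(0 : ℂ), (p : ℂ); (q : ℂ), 0]) (Y * !![(0 : ℂ), (p : ℂ); (q : ℂ), 0]) + fderiv ℝ f Y (Y * !![(0 : ℂ), (p : ℂ); (q : ℂ), 0] * !![(0 : ℂ), (p : ℂ); (q : ℂ), 0])) +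
        (fderiv ℝ (fderiv ℝ f) Y (Y * !![(0 : ℂ), -((p : ℂ) * I); (q : ℂ) * I, 0]) (Y * !![(0 : ℂ), -((p : ℂ) * I); (q : ℂ) * I, 0]) + fderiv ℝ f Y (Y * !![(0 : ℂ), -((p : ℂ) * I); (q : ℂ) * I, 0] * !![(0 : ℂ), -((p : ℂ) * I); (q : ℂ) * I, 0])))
    {O O' O'' OΩ : ℝ → E} (hO : ∀ ψ : ℝ, O ψ = ∫ h : archLocal L 2 (Matrix.diagonal a) w, f (((h : GL (Fin 2) ℂ) : Matrix (Fin 2) (Fin 2) ℂ) * M ψ * (((h⁻¹ : archLocal L 2 (Matrix.diagonal a) w) : GL (Fin 2) ℂ) : Matrix (Fin 2) (Fin 2) ℂ)) ∂μ)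
    (hO' : ∀ ψ : ℝ, O' ψ = ∫ h : archLocal L 2 (Matrix.diagonal a) w, fderiv ℝ f (((h : GL (Fin 2) ℂ) : Matrix (Fin 2) (Fin 2) ℂ) * M ψ * (((h⁻¹ : archLocal L 2 (Matrix.diagonal a) w) : GL (Fin 2) ℂ) : Matrix (Fin 2) (Fin 2) ℂ)) (((h : GL (Fin 2) ℂ) : Matrix (Fin 2) (Fin 2) ℂ) * (M ψ * !![I, 0; 0, -I]) * (((h⁻¹ : archLocal L 2 (Matrix.diagonal a) w) : GL (Fin 2) ℂ) : Matrix (Fin 2) (Fin 2) ℂ)) ∂μ)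
    (hO'' : ∀ ψ : ℝ, O'' ψ = ∫ h : archLocal L 2 (Matrix.diagonal a) w, (fderiv ℝ (fderiv ℝ f) (((h : GL (Fin 2) ℂ) : Matrix (Fin 2) (Fin 2) ℂ) * M ψ * (((h⁻¹ : archLocal L 2 (Matrix.diagonal a) w) : GL (Fin 2) ℂ) : Matrix (Fin 2) (Fin 2) ℂ)) (((h : GL (Fin 2) ℂ) : Matrix (Fin 2) (Fin 2) ℂ) * (M ψ * !![I, 0; 0, -I]) * (((h⁻¹ : archLocal L 2 (Matrix.diagonal a) w) : GL (Fin 2) ℂ) : Matrix (Fin 2) (Fin 2) ℂ)) (((h : GL (Fin 2) ℂ) : Matrix (Fin 2) (Fin 2) ℂ) * (M ψ * !![I, 0; 0, -I]) * (((h⁻¹ : archLocal L 2 (Matrix.diagonal a) w) : GL (Fin 2) ℂ) : Matrix (Fin 2) (Fin 2) ℂ)) + fderiv ℝ f (((h : GL (Fin 2) ℂ) : Matrix (Fin 2) (Fin 2) ℂ) * M ψ * (((h⁻¹ : archLocal L 2 (Matrix.diagonal a) w) : GL (Fin 2) ℂ) : Matrix (Fin 2) (Fin 2) ℂ)) (((h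 : GL (Fin 2) ℂ) : Matrix (Fin 2) (Fin 2) ℂ) * (M ψ * !![I, 0; 0, -I] * !![I, 0; 0, -I]) * (((h⁻¹ : archLocal L 2 (Matrix.diagonal a) w) : GL (Fin 2) ℂ) : Matrix (Fin 2) (Fin 2) ℂ))) ∂μ)
    (hOΩ : ∀ ψ : ℝ, OΩ ψ = ∫ h : archLocal L 2 (Matrix.diagonal a) w, Ω (((h : GL (Fin 2) ℂ) : Matrix (Fin 2) (Fin 2) ℂ) * M ψ * (((h⁻¹ : archLocal L 2 (Matrix.diagonal a) w) : GL (Fin 2) ℂ) : Matrix (Fin 2) (Fin 2) ℂ)) ∂μ)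
    {ψ : ℝ} (hψ : Real.sin ψ ≠ 0) :
    Real.sin ψ ^ 2 • (OΩ ψ + O'' ψ) + (2 * Real.sin ψ * Real.cos ψ) • O' ψ = 0 := by
  -- the form `H = σ_w(diag a) = diag(e)`
  obtain ⟨e, he_def⟩ : ∃ e : Fin 2 → ℂ, e = fun i => w.1.embedding (a i) := ⟨_, rfl⟩
  have hJ : (Matrix.diagonal a).map w.1.embedding = Matrix.diagonal e := by rw [he_def]; exact Matrix.diagonal_map (map_zero _)
  have he : ∀ k, e k ≠ 0 := fun k => by rw [he_def]; exact (map_ne_zero _).2 (ha k)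
  have hereal : ∀ k, conj (e k) = e k := fun k => by rw [he_def]; exact Complex.conj_eq_iff_im.2 (hreal k)
  have hqe' : (q : ℂ) ^ 2 * e 1 = -e 0 := by rw [he_def]; exact hqe
  -- the torus point is regular
  have hζ : Function.Injective ![z * Circle.exp ψ, z * Circle.exp (-ψ)] := by
    intro i j hij
    fin_cases i <;> fin_cases j
    · rfl
    · exact absurd hij (torusPoint_ne z hψ)
    · exact absurd hij.symm (torusPoint_ne z hψ)
    · rfl
  have hMζ : M ψ = Matrix.diagonal fun i => ((![z * Circle.exp ψ, z * Circle.exp (-ψ)] i : Circle) : ℂ) := by rw [hM, coe_torusVec]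
  -- §3 for the two boost generators `X̂₂`, `X̂₃` (★ Z1 §1: `X̂_k² = 1`, `X̂_kᴴH = −HX̂_k`)
  obtain ⟨hI₂, h₂⟩ := integral_boostJet_eq_zero L a w μ ha f hf hfc !![(0 : ℂ), (p : ℂ); (q : ℂ), 0] (Xh₂_mul_Xh₂ hpq)
    (by rw [hJ]; exact star_Xh₂_mul_diagonal hpq e hqe') hζ hMζ
  obtain ⟨hI₃, h₃⟩ := integral_boostJet_eq_zero L a w μ ha f hf hfc !![(0 : ℂ), -((p : ℂ) * I); (q : ℂ) * I, 0] (Xh₃_mul_Xh₃ hpq)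
    (by rw [hJ]; exact star_Xh₃_mul_diagonal hpq e hqe') hζ hMζ
  -- integrability of the torus-curve jets and of `Ω ∘ Ad(M)`
  obtain ⟨hI', hI'', -, -⟩ := hasDerivAt_orbitalIntegral_torusCurve L a w μ ha f hf hfc z hM hO hO' hO'' hψ
  have hIΩ : Integrable (fun h : archLocal L 2 (Matrix.diagonal a) w => Ω (((h : GL (Fin 2) ℂ) : Matrix (Fin 2) (Fin 2) ℂ) * M ψ * (((h⁻¹ : archLocal L 2 (Matrix.diagonal a) w) : GL (Fin 2) ℂ) : Matrix (Fin 2) (Fin 2) ℂ))) μ := by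
    have hf1 := hf.fderiv_right (m := 1) (by norm_num)
    have h2c : Continuous (fderiv ℝ (fderiv ℝ f)) := hf1.continuous_fderiv one_ne_zero
    have h1c : Continuous (fderiv ℝ f) := hf.continuous_fderiv two_ne_zero
    have hB : ∀ X : Matrix (Fin 2) (Fin 2) ℂ, Continuous fun Y : Matrix (Fin 2) (Fin 2) ℂ => fderiv ℝ (fderiv ℝ f) Y (Y * X) (Y * X) := fun X =>
      (h2c.clm_apply (continuous_id.mul continuous_const)).clm_apply (continuous_id.mul continuous_const)
    have hl : ∀ X : Matrix (Fin 2) (Fin 2) ℂ, Continuous fun Y : Matrix (Fin 2) (Fin 2) ℂ => fderiv ℝ f Y (Y * X * X) := fun X =>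
      h1c.clm_apply ((continuous_id.mul continuous_const).mul continuous_const)
    have hΩc : Continuous Ω := by
      rw [funext hΩ]
      exact (((hB _).add (hl _)).neg.add ((hB _).add (hl _))).add ((hB _).add (hl _))
    have hYc : Continuous fun h : archLocal L 2 (Matrix.diagonal a) w => ((h : GL (Fin 2) ℂ) : Matrix (Fin 2) (Fin 2) ℂ) * M ψ * (((h⁻¹ : archLocal L 2 (Matrix.diagonal a) w) : GL (Fin 2) ℂ) : Matrix (Fin 2) (Fin 2) ℂ) :=
      (((Units.continuous_val.comp continuous_subtype_val).mul continuous_const).mul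
        (Units.continuous_val.comp (continuous_subtype_val.comp continuous_inv)))
    have hK₀ := isCompact_setOf_conj_diagonal_mem L a w ha hfc.isCompact hζ
    rw [← hMζ] at hK₀
    refine (hΩc.comp hYc).integrable_of_hasCompactSupport (HasCompactSupport.intro hK₀ fun h hh => ?_)
    obtain ⟨-, h1, h2⟩ := eq_zero_of_notMem_tsupport f hh
    show Ω (((h : GL (Fin 2) ℂ) : Matrix (Fin 2) (Fin 2) ℂ) * M ψ * (((h⁻¹ : archLocal L 2 (Matrix.diagonal a) w) : GL (Fin 2) ℂ) : Matrix (Fin 2) (Fin 2) ℂ)) = 0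
    rw [hΩ, h1, h2]
    simp
  -- §4 pointwise, at every `h ∈ G₂` (`TᴴHT = H`, `TT′ = 1`)
  have hpt : ∀ h : archLocal L 2 (Matrix.diagonal a) w,
      fderiv ℝ (fderiv ℝ f) (((h : GL (Fin 2) ℂ) : Matrix (Fin 2) (Fin 2) ℂ) * M ψ * (((h⁻¹ : archLocal L 2 (Matrix.diagonal a) w) : GL (Fin 2) ℂ) : Matrix (Fin 2) (Fin 2) ℂ)) (((h : GL (Fin 2) ℂ) : Matrix (Fin 2) (Fin 2) ℂ) * (!![(0 : ℂ), (p : ℂ); (q : ℂ), 0] * M ψ - M ψ * !![(0 : ℂ), (p : ℂ); (q : ℂ), 0]) * (((h⁻¹ : archLocal L 2 (Matrix.diagonal a) w) : GL (Fin 2) ℂ) : Matrix (Fin 2) (Fin 2) ℂ)) (((h : GL (Fin 2) ℂ) : Matrix (Fin 2) (Fin 2) ℂ) * (!![(0 : ℂ), (p : ℂ); (q : ℂ), 0] * M ψ - M ψ * !![(0 : ℂ), (p : ℂ); (q : ℂ), 0]) * (((h⁻¹ : archLocal L 2 (Matrix.diagonal a) w) : GL (Fin 2) ℂ) : Matrix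 (Fin 2) (Fin 2) ℂ)) +
          fderiv ℝ f (((h : GL (Fin 2) ℂ) : Matrix (Fin 2) (Fin 2) ℂ) * M ψ * (((h⁻¹ : archLocal L 2 (Matrix.diagonal a) w) : GL (Fin 2) ℂ) : Matrix (Fin 2) (Fin 2) ℂ)) (((h : GL (Fin 2) ℂ) : Matrix (Fin 2) (Fin 2) ℂ) * ((2 : ℂ) • M ψ - (2 : ℂ) • (!![(0 : ℂ), (p : ℂ); (q : ℂ), 0] * M ψ * !![(0 : ℂ), (p : ℂ); (q : ℂ), 0])) * (((h⁻¹ : archLocal L 2 (Matrix.diagonal a) w) : GL (Fin 2) ℂ) : Matrix (Fin 2) (Fin 2) ℂ)) +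
        (fderiv ℝ (fderiv ℝ f) (((h : GL (Fin 2) ℂ) : Matrix (Fin 2) (Fin 2) ℂ) * M ψ * (((h⁻¹ : archLocal L 2 (Matrix.diagonal a) w) : GL (Fin 2) ℂ) : Matrix (Fin 2) (Fin 2) ℂ)) (((h : GL (Fin 2) ℂ) : Matrix (Fin 2) (Fin 2) ℂ) * (!![(0 : ℂ), -((p : ℂ) * I); (q : ℂ) * I, 0] * M ψ - M ψ * !![(0 : ℂ), -((p : ℂ) * I); (q : ℂ) * I, 0]) * (((h⁻¹ : archLocal L 2 (Matrix.diagonal a) w) : GL (Fin 2) ℂ) : Matrix (Fin 2) (Fin 2) ℂ)) (((h : GL (Fin 2) ℂ) : Matrix (Fin 2) (Fin 2) ℂ) * (!![(0 : ℂ), -((p : ℂ) * I); (q : ℂ) * I, 0] * M ψ - M ψ * !![(0 : ℂ), -((p : ℂ) * I); (q : ℂ) * I, 0]) * (((h⁻¹ : archLocal L 2 (Matrix.diagonal a) w) : GL (Fin 2) ℂ) : Matrix (Fin 2) (Fin 2) ℂ)) +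
          fderiv ℝ f (((h : GL (Fin 2) ℂ) : Matrix (Fin 2) (Fin 2) ℂ) * M ψ * (((h⁻¹ : archLocal L 2 (Matrix.diagonal a) w) : GL (Fin 2) ℂ) : Matrix (Fin 2) (Fin 2) ℂ)) (((h : GL (Fin 2) ℂ) : Matrix (Fin 2) (Fin 2) ℂ) * ((2 : ℂ) • M ψ - (2 : ℂ) • (!![(0 : ℂ), -((p : ℂ) * I); (q : ℂ) * I, 0] * M ψ * !![(0 : ℂ), -((p : ℂ) * I); (q : ℂ) * I, 0])) * (((h⁻¹ : archLocal L 2 (Matrix.diagonal a) w) : GL (Fin 2) ℂ) : Matrix (Fin 2) (Fin 2) ℂ))) =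
      (2 - 2 * Real.cos (2 * ψ)) • (Ω (((h : GL (Fin 2) ℂ) : Matrix (Fin 2) (Fin 2) ℂ) * M ψ * (((h⁻¹ : archLocal L 2 (Matrix.diagonal a) w) : GL (Fin 2) ℂ) : Matrix (Fin 2) (Fin 2) ℂ)) + (fderiv ℝ (fderiv ℝ f) (((h : GL (Fin 2) ℂ) : Matrix (Fin 2) (Fin 2) ℂ) * M ψ * (((h⁻¹ : archLocal L 2 (Matrix.diagonal a) w) : GL (Fin 2) ℂ) : Matrix (Fin 2) (Fin 2) ℂ)) (((h : GL (Fin 2) ℂ) : Matrix (Fin 2) (Fin 2) ℂ) * (M ψ * !![I, 0; 0, -I]) * (((h⁻¹ : archLocal L 2 (Matrix.diagonal a) w) : GL (Fin 2) ℂ) : Matrix (Fin 2) (Fin 2) ℂ)) (((h : GL (Fin 2) ℂ) : Matrix (Fin 2) (Fin 2) ℂ) * (M ψ * !![I, 0; 0, -I]) * (((h⁻¹ : archLocal L 2 (Matrix.diagonal a) w) : GL (Fin 2) ℂ) : Matrix (Fin 2) (Fin 2) ℂ)) + fderiv ℝ f (((h : GL (Fin 2) ℂ) : Matrix (Fin 2)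 (Fin 2) ℂ) * M ψ * (((h⁻¹ : archLocal L 2 (Matrix.diagonal a) w) : GL (Fin 2) ℂ) : Matrix (Fin 2) (Fin 2) ℂ)) (((h : GL (Fin 2) ℂ) : Matrix (Fin 2) (Fin 2) ℂ) * (M ψ * !![I, 0; 0, -I] * !![I, 0; 0, -I]) * (((h⁻¹ : archLocal L 2 (Matrix.diagonal a) w) : GL (Fin 2) ℂ) : Matrix (Fin 2) (Fin 2) ℂ)))) + (4 * Real.sin (2 * ψ)) • fderiv ℝ f (((h : GL (Fin 2) ℂ) : Matrix (Fin 2) (Fin 2) ℂ) * M ψ * (((h⁻¹ : archLocal L 2 (Matrix.diagonal a) w) : GL (Fin 2) ℂ) : Matrix (Fin 2) (Fin 2) ℂ)) (((h : GL (Fin 2) ℂ) : Matrix (Fin 2) (Fin 2) ℂ) * (M ψ * !![I, 0; 0, -I]) * (((h⁻¹ : archLocal L 2 (Matrix.diagonal a) w) : GL (Fin 2) ℂ) : Matrix (Fin 2) (Fin 2) ℂ)) := fun h => by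
    have hT := (mem_archLocal_iff_conjTranspose L 2 (Matrix.diagonal a) w (h : GL (Fin 2) ℂ)).1 h.2
    rw [hJ] at hT
    have hTT' : ((h : GL (Fin 2) ℂ) : Matrix (Fin 2) (Fin 2) ℂ) * (((h⁻¹ : archLocal L 2 (Matrix.diagonal a) w) : GL (Fin 2) ℂ) : Matrix (Fin 2) (Fin 2) ℂ) = 1 := by rw [Subgroup.coe_inv, Units.mul_inv]
    rw [hΩ]
    exact boost_jets_sum_eq_radial (fderiv ℝ (fderiv ℝ f) (((h : GL (Fin 2) ℂ) : Matrix (Fin 2) (Fin 2) ℂ) * M ψ * (((h⁻¹ : archLocal L 2 (Matrix.diagonal a) w) : GL (Fin 2) ℂ) : Matrix (Fin 2) (Fin 2) ℂ))) (fderiv ℝ f (((h : GL (Fin 2) ℂ) : Matrix (Fin 2) (Fin 2) ℂ) * M ψ * (((h⁻¹ : archLocal L 2 (Matrix.diagonal a) w) : GL (Fin 2) ℂ) : Matrix (Fin 2) (Fin 2) ℂ))) hpq e he hereal hqe' hT hTT' (z : ℂ) ψ (hM ψ)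
  -- integrate: `0 = ∫ (J₂ + J₃) = (2 − 2cos 2ψ) • (O_Ω + O″) + (4 sin 2ψ) • O′`
  have hsum := integral_add hI₂ hI₃
  rw [h₂, h₃, add_zero] at hsum
  have key := (integral_congr_ae (Eventually.of_forall hpt)).symm.trans hsum
  have hI1 : Integrable (fun h : archLocal L 2 (Matrix.diagonal a) w => (2 - 2 * Real.cos (2 * ψ)) • (Ω (((h : GL (Fin 2) ℂ) : Matrix (Fin 2) (Fin 2) ℂ) * M ψ * (((h⁻¹ : archLocal L 2 (Matrix.diagonal a) w) : GL (Fin 2) ℂ) : Matrix (Fin 2) (Fin 2) ℂ)) + (fderiv ℝ (fderiv ℝ f) (((h : GL (Fin 2) ℂ) : Matrix (Fin 2) (Fin 2) ℂ) * M ψ * (((h⁻¹ : archLocal L 2 (Matrix.diagonal a) w) : GL (Fin 2) ℂ) : Matrix (Fin 2) (Fin 2) ℂ)) (((h : GL (Fin 2) ℂ) : Matrix (Fin 2) (Fin 2) ℂ) * (M ψ * !![I, 0; 0, -I]) * (((h⁻¹ : archLocal L 2 (Matrix.diagonal a) w) : GL (Fin 2) ℂ) : Matrix (Fin 2) (Fin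 2) ℂ)) (((h : GL (Fin 2) ℂ) : Matrix (Fin 2) (Fin 2) ℂ) * (M ψ * !![I, 0; 0, -I]) * (((h⁻¹ : archLocal L 2 (Matrix.diagonal a) w) : GL (Fin 2) ℂ) : Matrix (Fin 2) (Fin 2) ℂ)) + fderiv ℝ f (((h : GL (Fin 2) ℂ) : Matrix (Fin 2) (Fin 2) ℂ) * M ψ * (((h⁻¹ : archLocal L 2 (Matrix.diagonal a) w) : GL (Fin 2) ℂ) : Matrix (Fin 2) (Fin 2) ℂ)) (((h : GL (Fin 2) ℂ) : Matrix (Fin 2) (Fin 2) ℂ) * (M ψ * !![I, 0; 0, -I] * !![I, 0; 0, -I]) * (((h⁻¹ : archLocal L 2 (Matrix.diagonal a) w) : GL (Fin 2) ℂ) : Matrix (Fin 2) (Fin 2) ℂ))))) μ :=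
    (hIΩ.add hI'').smul _
  have hI2 : Integrable (fun h : archLocal L 2 (Matrix.diagonal a) w => (4 * Real.sin (2 * ψ)) • fderiv ℝ f (((h : GL (Fin 2) ℂ) : Matrix (Fin 2) (Fin 2) ℂ) * M ψ * (((h⁻¹ : archLocal L 2 (Matrix.diagonal a) w) : GL (Fin 2) ℂ) : Matrix (Fin 2) (Fin 2) ℂ)) (((h : GL (Fin 2) ℂ) : Matrix (Fin 2) (Fin 2) ℂ) * (M ψ * !![I, 0; 0, -I]) * (((h⁻¹ : archLocal L 2 (Matrix.diagonal a) w) : GL (Fin 2) ℂ) : Matrix (Fin 2) (Fin 2) ℂ))) μ := hI'.smul _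
  rw [integral_add hI1 hI2, integral_smul, integral_smul, integral_add hIΩ hI'', ← hOΩ, ← hO'', ← hO'] at key
  -- `2 − 2cos 2ψ = 4 sin²ψ`, `4 sin 2ψ = 4·(2 sin ψ cos ψ)`; divide by `4`
  have hc : 2 - 2 * Real.cos (2 * ψ) = 4 * Real.sin ψ ^ 2 := by rw [Real.cos_two_mul, Real.cos_sq']; ring
  have hs : 4 * Real.sin (2 * ψ) = 4 * (2 * Real.sin ψ * Real.cos ψ) := by rw [Real.sin_two_mul]
  rw [hc, hs, mul_smul, mul_smul, ← smul_add] at key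
  exact (smul_eq_zero.1 key).resolve_left (by norm_num)

end Radial

end Literature.NumberTheory.Automorphic.RankOneCasimir
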